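import Literature.NumberTheory.Automorphic.CompactQuotientFiniteMultiplicity   -- ★ `multiplicity_lt_top_of_compactSpace`, `multiplicity_lt_top_cmDatum`, `anisotropic_of_posDef_map`
import Literature.NumberTheory.Automorphic.HilbertRepOrthogonalDecomposition     -- ★ `IsUnitary.multiplicity_eq_card_of_set`, `le_multiplicity_of_pairwise_isOrtho`
import Literature.NumberTheory.Automorphic.HilbertRepSpectrumProofs              -- ★ `AreUnitarilyEquivalent.trans`
import HarnessLib

/-!
# Crux `H413`, floor 0, programme F0P3 — THE CLASS TOKENS OF RECORD `Cls₀ ∕ cl₀ ∕ mult₀` for the ED. 4 kit instance `𝔠₀`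

Cell hodgecm-mathlib (D-0151), sub-cell F0/P3 «U3-mult»; pen F0P3-p04 (g6); bid (b′) 2026-08-31 to F0P3-plan (g4) (the class-level
brick next to p02 (g6)'s local `clFinChoice`, RULING (V24)(d)).  DEF lane (`--kind definition --supports stmt-HodgeConjecture-24833`):
three definitions WITH BODY and their API; no instance, no notation, no named fact, no `sorry`; kit-free (imports neither a `Lines`
module nor the T5 Theorems edition).

WHAT IT PROVIDES for the dossier record `Cruxes/H413/Lines/F0_T5InnerFormClassification.lean` (v3.1, fields `Cls`, `cl`, `mult` of
`structure ClassificationKit`, pin (i) of `IsPinned`, law `ClassEq`, and the «`Cls` = ISOMORPHISM classes» proviso of law `FlathDet`):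
for ANY adelic group datum `𝒢` with an automorphic measure `μ`,

* `clsSetoid 𝒢 μ` — unitary equivalence of the underlying irreducible closed invariant subspaces `P.space ≤ L²(X, μ)` of discrete
  automorphic representations (★ `ContRepresentation.AreUnitarilyEquivalent`, an equivalence relation by ★ `refl ∕ symm ∕ trans`);
* `Cls 𝒢 μ := Quotient (clsSetoid 𝒢 μ)` and `cl 𝒢 μ P := ⟦P⟧` — so `cl P = cl P′ ↔ P ≃ P′` (`cl_eq_cl_iff`, the law `ClassEq` at `𝔠₀` by
  `exact`) and `cl` is surjective (`cl_surjective`, `cl_rep`);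
* `mult 𝒢 μ c : ℕ` — the multiplicity `m(π′)` of the class in `L²` [Rogawski1990 §14.5 p. 237], i.e. ★ `ContRepresentation.multiplicity`
  of any representative, as a natural number (`multiplicity_congr_right`: the ★ multiplicity is a class function of its second argument);
* **pin (i) AS A THEOREM**: `coe_mult_cl : ((mult (cl P) : ℕ) : ℕ∞) = multiplicity (rightRegular μ) P.space.toContRep` on a compact quotient
  (★ `multiplicity_lt_top_of_compactSpace` [DeitmarEchterhoff2014 Thm. 9.2.2]); for the inner forms `G′ = U(H)`, `H` anisotropic, at every
  rank (`coe_mult_cl_cmDatum`) and in the frame of the letters line (`coe_mult_cl_of_frame`: `H` definite off `ι`, `[L⁺:ℚ] ≥ 2`);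
* `exists_mem_areUnitarilyEquivalent_of_decomposition`: every discrete `P` is unitarily equivalent to a member of EVERY orthogonal decomposition
  of `L²` into irreducibles with dense span (★ `IsUnitary.multiplicity_eq_card_of_set` + `1 ≤ m(P)`) — the regrouping `Cls₀ ↔ range q` behind
  «`T_{G′}(f′) = Σ_{π′} m(π′) tr π′(f′)`» (★ `AutomorphicQuotientSpectralExpansionPolar.diagTrace_hasSum_multiplicity_mul_tsum_inner`).

References: [Rogawski1990] J. Rogawski, *Automorphic Representations of Unitary Groups in Three Variables* (1990), §14.5 p. 237;
[DeitmarEchterhoff2014] A. Deitmar, S. Echterhoff, *Principles of Harmonic Analysis*, 2nd ed. (2014), Thm. 9.2.2; [Dixmier1977] J. Dixmier,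
*C*-algebras* (1977), §5.4.
-/

set_option autoImplicit false
-- the mandated namespace has the single-problem summit's repeated segment (`HodgeConjecture.HodgeConjecture`)
set_option linter.dupNamespace false

noncomputable section

namespace Summit.HodgeConjecture.HodgeConjecture.Cruxes.H413.F0P3ClassTokensOfRecord

open MeasureTheory NumberField
open Literature.NumberTheory.Automorphic
open ContRepresentation (AreUnitarilyEquivalent ClosedSubrep)

universe u

section Generic

variable {K : Type} [Field K] [NumberField K] (𝒢 : AdelicGroupData.{u} K)
  (μ : Measure 𝒢.automorphicQuotient) [𝒢.IsAutomorphicMeasure μ]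

/-! ## §1 Classes of discrete automorphic representations -/

/-- **Unitary equivalence of discrete automorphic representations** — the setoid on `DiscreteAutomorphicRep 𝒢 μ` whose relation is unitary
equivalence of the underlying irreducible closed invariant subspaces of `L²(X, μ)` [Rogawski1990 §14.5 p. 237: the classes `π′`; Dixmier1977 §5.4]. -/
def clsSetoid : Setoid (DiscreteAutomorphicRep 𝒢 μ) where
  r P P' := AreUnitarilyEquivalent P.space.toContRep P'.space.toContRep
  iseqv := ⟨fun P => AreUnitarilyEquivalent.refl P.space.toContRep, fun h => h.symm, fun h₁ h₂ => h₁.trans h₂⟩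

/-- **The class type of record `Cls₀`**: unitary-equivalence classes of discrete automorphic representations of `𝒢` in `L²(X, μ)` — the
carrier of the kit field `Cls` at the ED. 4 instance [Rogawski1990 §14.5 p. 237]. -/
def Cls : Type u := Quotient (clsSetoid 𝒢 μ)

/-- **The class map of record `cl₀`**: a discrete `P` to its unitary-equivalence class [Rogawski1990 §14.5 p. 237]. -/
def cl (P : DiscreteAutomorphicRep 𝒢 μ) : Cls 𝒢 μ := Quotient.mk (clsSetoid 𝒢 μ) P

/-- `cl P = cl P′` iff `P ≃ P′` unitarily — the T5 law `ClassEq` at `𝔠₀` [Dixmier1977 §5.4]. -/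
theorem cl_eq_cl_iff (P P' : DiscreteAutomorphicRep 𝒢 μ) :
    cl 𝒢 μ P = cl 𝒢 μ P' ↔ AreUnitarilyEquivalent P.space.toContRep P'.space.toContRep :=
  Quotient.eq (r := clsSetoid 𝒢 μ)

/-- `cl` is surjective: every class of record is the class of some discrete `P`. [folklore] -/
theorem cl_surjective : Function.Surjective (cl 𝒢 μ) :=
  Quotient.mk_surjective

/-- A chosen representative of a class. [folklore] -/
def rep (c : Cls 𝒢 μ) : DiscreteAutomorphicRep 𝒢 μ := Quotient.out (s := clsSetoid 𝒢 μ) c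

/-- `cl (rep c) = c`. [folklore] -/
@[simp] theorem cl_rep (c : Cls 𝒢 μ) : cl 𝒢 μ (rep 𝒢 μ c) = c :=
  Quotient.out_eq (s := clsSetoid 𝒢 μ) c

/-- `rep (cl P) ≃ P` unitarily. [folklore] -/
theorem rep_cl_areUnitarilyEquivalent (P : DiscreteAutomorphicRep 𝒢 μ) :
    AreUnitarilyEquivalent (rep 𝒢 μ (cl 𝒢 μ P)).space.toContRep P.space.toContRep :=
  (cl_eq_cl_iff 𝒢 μ _ _).1 (cl_rep 𝒢 μ (cl 𝒢 μ P))

/-- Induction on classes: a property of classes holds everywhere once it holds at every `cl P`. [folklore] -/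
theorem cls_ind {p : Cls 𝒢 μ → Prop} (h : ∀ P, p (cl 𝒢 μ P)) (c : Cls 𝒢 μ) : p c :=
  Quotient.ind (motive := p) h c

end Generic

/-! ## §2 The multiplicity token `mult₀` and pin (i) -/

section Multiplicity

/-- **★ `ContRepresentation.multiplicity π σ` is a class function of `σ`**: unitarily equivalent `σ ≃ σ′` have the same multiplicity in `π`
(the definition quantifies over members `W ≤ π` with `W ≃ σ`; compose with `σ ≃ σ′`, ★ `AreUnitarilyEquivalent.trans`). [Dixmier1977 §5.4] -/
theorem multiplicity_congr_right {G H H' H'' : Type*} [Group G] [NormedAddCommGroup H] [InnerProductSpace ℂ H] [CompleteSpace H]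
    [SeminormedAddCommGroup H'] [Module ℂ H'] [SeminormedAddCommGroup H''] [Module ℂ H'']
    (π : ContRepresentation ℂ G H) {σ : ContRepresentation ℂ G H'} {σ' : ContRepresentation ℂ G H''}
    (h : AreUnitarilyEquivalent σ σ') : π.multiplicity σ = π.multiplicity σ' := by
  unfold ContRepresentation.multiplicity
  apply le_antisymm
  · refine iSup_le fun s => iSup_le fun hs => iSup_le fun ho => ?_
    exact le_iSup_of_le s (le_iSup_of_le (fun W hW => ⟨(hs W hW).1, (hs W hW).2.trans h⟩) (le_iSup_of_le ho le_rfl))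
  · refine iSup_le fun s => iSup_le fun hs => iSup_le fun ho => ?_
    exact le_iSup_of_le s (le_iSup_of_le (fun W hW => ⟨(hs W hW).1, (hs W hW).2.trans h.symm⟩) (le_iSup_of_le ho le_rfl))

variable {K : Type} [Field K] [NumberField K] (𝒢 : AdelicGroupData.{u} K)
  (μ : Measure 𝒢.automorphicQuotient) [𝒢.IsAutomorphicMeasure μ]

/-- **The multiplicity token of record `mult₀ c : ℕ`** — `m(π′)`, the multiplicity in `L²(X, μ)` of the class `π′` [Rogawski1990 §14.5 p. 237:
«`T_{G′}(f′) = Σ_{π′} m(π′) tr π′(f′)`»]: the ★ `ℕ∞`-valued `ContRepresentation.multiplicity` of a representative, truncated to `ℕ` (no truncation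
occurs on a compact quotient, `coe_mult_cl`). -/
def mult (c : Cls 𝒢 μ) : ℕ := ((𝒢.rightRegular μ).multiplicity (rep 𝒢 μ c).space.toContRep).toNat

/-- `mult (cl P) = (m(P)).toNat` — independent of the representative (`multiplicity_congr_right`). [Dixmier1977 §5.4] -/
theorem mult_cl (P : DiscreteAutomorphicRep 𝒢 μ) : mult 𝒢 μ (cl 𝒢 μ P) = ((𝒢.rightRegular μ).multiplicity P.space.toContRep).toNat := by
  unfold mult
  rw [multiplicity_congr_right ((𝒢.rightRegular μ)) (rep_cl_areUnitarilyEquivalent 𝒢 μ P)]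

/-- **`1 ≤ m(P)`**: a discrete `P` occurs in `L²` (★ `le_multiplicity_of_pairwise_isOrtho` on the one-member family `{P.space}`). [Dixmier1977 §5.4] -/
theorem one_le_multiplicity (P : DiscreteAutomorphicRep 𝒢 μ) : (1 : ℕ∞) ≤ (𝒢.rightRegular μ).multiplicity P.space.toContRep := by
  have h := ContRepresentation.le_multiplicity_of_pairwise_isOrtho (π := 𝒢.rightRegular μ) (W := fun _ : Unit => P.space)
    (fun _ => P.irreducible) (fun i j hij => absurd (Subsingleton.elim i j) hij) (σ := P.space.toContRep) Finset.univ
    (fun _ _ => AreUnitarilyEquivalent.refl _)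
  simpa using h

/-- **PIN (i) on a compact quotient**: `((mult (cl P) : ℕ) : ℕ∞) = m(P)` — the multiplicity of a discrete `P` in `L²` of a compact automorphic
quotient is finite (★ `multiplicity_lt_top_of_compactSpace` [DeitmarEchterhoff2014 Thm. 9.2.2]), so the `ℕ`-valued token IS the multiplicity. -/
theorem coe_mult_cl [LocallyCompactSpace 𝒢.Adelic] [SecondCountableTopology 𝒢.Adelic] [CompactSpace 𝒢.automorphicQuotient]
    (P : DiscreteAutomorphicRep 𝒢 μ) : ((mult 𝒢 μ (cl 𝒢 μ P) : ℕ) : ℕ∞) = (𝒢.rightRegular μ).multiplicity P.space.toContRep := by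
  rw [mult_cl]
  exact ENat.coe_toNat (𝒢.multiplicity_lt_top_of_compactSpace μ P.space (ClosedSubrep.ne_bot_of_isTopIrreducible P.irreducible)).ne

/-- `1 ≤ mult (cl P)` on a compact quotient. [DeitmarEchterhoff2014 Thm. 9.2.2] -/
theorem one_le_mult_cl [LocallyCompactSpace 𝒢.Adelic] [SecondCountableTopology 𝒢.Adelic] [CompactSpace 𝒢.automorphicQuotient]
    (P : DiscreteAutomorphicRep 𝒢 μ) : 1 ≤ mult 𝒢 μ (cl 𝒢 μ P) := by
  have h := one_le_multiplicity 𝒢 μ P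
  rw [← coe_mult_cl 𝒢 μ P] at h
  exact_mod_cast h

/-- `1 ≤ mult c` for every class on a compact quotient (every class is some `cl P`). [DeitmarEchterhoff2014 Thm. 9.2.2] -/
theorem one_le_mult [LocallyCompactSpace 𝒢.Adelic] [SecondCountableTopology 𝒢.Adelic] [CompactSpace 𝒢.automorphicQuotient]
    (c : Cls 𝒢 μ) : 1 ≤ mult 𝒢 μ c :=
  cls_ind 𝒢 μ (p := fun c => 1 ≤ mult 𝒢 μ c) (one_le_mult_cl 𝒢 μ) c

/-! ## §3 Every class of record is represented in every orthogonal decomposition of `L²` into irreducibles -/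

/-- **Every discrete `P` is unitarily equivalent to a member of every orthogonal decomposition `S` of `L²(X, μ)` into irreducibles with dense
span**: `m(P) = #{W ∈ S | W ≃ P}` (★ `IsUnitary.multiplicity_eq_card_of_set` [Dixmier1977 5.4.6]) and `m(P) ≥ 1`.  This is the regrouping
`Cls₀ ↔ range q` behind «`T_{G′}(f′) = Σ_{π′} m(π′) tr π′(f′)`» [Rogawski1990 §14.5 p. 237] (★ `diagTrace_hasSum_multiplicity_mul_tsum_inner`). -/
theorem exists_mem_areUnitarilyEquivalent_of_decomposition (P : DiscreteAutomorphicRep 𝒢 μ)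
    {S : Set (ClosedSubrep (𝒢.rightRegular μ))} (hirr : ∀ W ∈ S, W.toContRep.IsTopIrreducible)
    (horth : S.Pairwise fun W W' => W.toSubmodule ⟂ W'.toSubmodule) (hdense : ClosedSubrep.iSupClosure S = ⊤) :
    ∃ W ∈ S, AreUnitarilyEquivalent W.toContRep P.space.toContRep := by
  have hcard := (𝒢.isUnitary_rightRegular μ).multiplicity_eq_card_of_set hirr horth hdense P.space.toContRep
  have h1 := one_le_multiplicity 𝒢 μ P
  rw [hcard] at h1
  have hne : Nonempty {W : S // AreUnitarilyEquivalent (W : ClosedSubrep (𝒢.rightRegular μ)).toContRep P.space.toContRep} := by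
    by_contra h0
    rw [not_nonempty_iff] at h0
    rw [ENat.card_eq_coe_natCard, Nat.card_of_isEmpty, Nat.cast_zero] at h1
    exact absurd h1 (by norm_num)
  obtain ⟨⟨W, hW⟩⟩ := hne
  exact ⟨W, W.2, hW⟩

/-- The class-valued reading: with `q : S → Cls₀`-style classifying data one gets, for every class `c`, a member `W ∈ S` with `W ≃ rep c`. [folklore] -/
theorem exists_mem_areUnitarilyEquivalent_rep (c : Cls 𝒢 μ)
    {S : Set (ClosedSubrep (𝒢.rightRegular μ))} (hirr : ∀ W ∈ S, W.toContRep.IsTopIrreducible)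
    (horth : S.Pairwise fun W W' => W.toSubmodule ⟂ W'.toSubmodule) (hdense : ClosedSubrep.iSupClosure S = ⊤) :
    ∃ W ∈ S, AreUnitarilyEquivalent W.toContRep (rep 𝒢 μ c).space.toContRep :=
  exists_mem_areUnitarilyEquivalent_of_decomposition 𝒢 μ (rep 𝒢 μ c) hirr horth hdense

end Multiplicity

/-! ## §4 The inner forms `G′ = U(H)`: pin (i) at every rank, and in the frame of the letters line -/

section UnitaryGroup

open Literature.NumberTheory.Automorphic.UnitaryGroup
open Literature.AlgebraicGeometry.ShimuraVarieties (hermForm)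
open scoped ComplexOrder

variable (L : Type) [Field L] [NumberField L] [IsCMField L] (N : ℕ) (H : Matrix (Fin N) (Fin N) L)
  (μ : Measure (cmDatum L N H).automorphicQuotient) [(cmDatum L N H).IsAutomorphicMeasure μ]

/-- **PIN (i) for `U(H)`, `H` anisotropic, every rank**: `((mult (cl P) : ℕ) : ℕ∞) = m(P)` (compact quotient ★ `compactSpace_cmDatum_automorphicQuotient`;
[Rogawski1990 §14.5 p. 237; DeitmarEchterhoff2014 Thm. 9.2.2]). -/
theorem coe_mult_cl_cmDatum (hanis : ∀ x : Fin N → L, hermForm (cmConjRingHom L) H x x = 0 → x = 0)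
    (P : DiscreteAutomorphicRep (cmDatum L N H) μ) :
    ((mult (cmDatum L N H) μ (cl (cmDatum L N H) μ P) : ℕ) : ℕ∞) = ((cmDatum L N H).rightRegular μ).multiplicity P.space.toContRep := by
  haveI := compactSpace_cmDatum_automorphicQuotient L N H hanis
  exact coe_mult_cl (cmDatum L N H) μ P

/-- `[L:ℚ] ≥ 4` once `[L⁺:ℚ] ≥ 2` (`[L:ℚ] = 2·[L⁺:ℚ]`). [folklore] -/
private theorem four_le_finrank_of_two_le (h2 : 2 ≤ Module.finrank ℚ ↥(maximalRealSubfield L)) : 4 ≤ Module.finrank ℚ L := by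
  have h := Module.finrank_mul_finrank ℚ ↥(maximalRealSubfield L) L
  rw [Algebra.IsQuadraticExtension.finrank_eq_two ↥(maximalRealSubfield L) L] at h
  omega

/-- In the frame of the letters line — `H` positive definite at every complex place other than that of `ι`, `[L⁺:ℚ] ≥ 2` — `H` is ANISOTROPIC
(a second complex place exists, ★ `exists_infinitePlace_ne`; ★ `anisotropic_of_posDef_map`). [folklore] -/
theorem anisotropic_of_frame {N : ℕ} (H : Matrix (Fin N) (Fin N) L) (ι : L →+* ℂ)
    (hdef : ∀ τ' : L →+* ℂ, InfinitePlace.mk τ' ≠ InfinitePlace.mk ι → (H.map τ').PosDef)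
    (h2 : 2 ≤ Module.finrank ℚ ↥(maximalRealSubfield L)) :
    ∀ x : Fin N → L, hermForm (cmConjRingHom L) H x x = 0 → x = 0 := by
  obtain ⟨τ, hτ⟩ := exists_infinitePlace_ne L (four_le_finrank_of_two_le L h2) ι
  exact anisotropic_of_posDef_map L H τ (hdef τ hτ)

/-- **PIN (i) IN THE FRAME OF THE LETTERS LINE** (`N = 3`, `H` definite off `ι`, `[L⁺:ℚ] ≥ 2`; the binders of `shapeGuarded_of_T5`):
`((mult (cl P) : ℕ) : ℕ∞) = multiplicity (rightRegular μ) P.space.toContRep` — the first conjunct of `IsPinned` at `𝔠₀` by `exact`.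
[Rogawski1990 §14.5 p. 237; DeitmarEchterhoff2014 Thm. 9.2.2] -/
theorem coe_mult_cl_of_frame (ι : L →+* ℂ) (H : Matrix (Fin 3) (Fin 3) L)
    (hdef : ∀ τ' : L →+* ℂ, InfinitePlace.mk τ' ≠ InfinitePlace.mk ι → (H.map τ').PosDef)
    (h2 : 2 ≤ Module.finrank ℚ ↥(maximalRealSubfield L))
    (μ : Measure (cmDatum L 3 H).automorphicQuotient) [(cmDatum L 3 H).IsAutomorphicMeasure μ]
    (P : DiscreteAutomorphicRep (cmDatum L 3 H) μ) :
    ((mult (cmDatum L 3 H) μ (cl (cmDatum L 3 H) μ P) : ℕ) : ℕ∞) = ((cmDatum L 3 H).rightRegular μ).multiplicity P.space.toContRep :=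
  coe_mult_cl_cmDatum L 3 H μ (anisotropic_of_frame L H ι hdef h2) P

end UnitaryGroup

end Summit.HodgeConjecture.HodgeConjecture.Cruxes.H413.F0P3ClassTokensOfRecord

end
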